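import Summits.AtomisticToContinuum.Crystallization.Theses.PerronTransitivity
import Summits.AtomisticToContinuum.Crystallization.Theses.HullMinimality
import Summits.AtomisticToContinuum.Crystallization.Theorems.PhononSlackCertificatesPeriodicGivenLayered
import Summits.AtomisticToContinuum.Crystallization.Theorems.PerronTransitivityTransitiveLocalLimitStubExtract
import Summits.AtomisticToContinuum.Crystallization.Theorems.PerronTransitivityTransitiveLocalLimitStubPeriodTwoHullPoint
import Summits.AtomisticToContinuum.Crystallization.Theorems.PerronTransitivityTransitiveLocalLimitStubSiteSumConst
import Summits.AtomisticToContinuum.Crystallization.Theorems.PerronTransitivityTransitiveLocalLimitStubLevel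
import Summits.AtomisticToContinuum.Crystallization.Theorems.PerronTransitivityTransitiveLocalLimitEnergeticDoors
import Summits.AtomisticToContinuum.Crystallization.Theorems.PerronTransitivityTransitiveLocalLimitFiniteForm

/-!
# Crux `TransitiveLocalLimit` (stmt-AtomisticToContinuum-15100) — line `MotifTwo` (skeleton `Lines/MotifTwo.lean`)

Route `PerronTransitivity` (route-AtomisticToContinuum-PerronTransitivity), crux rank 4:

  `TransitiveLocalLimit` — every sequence of Lennard-Jones ground states `x N` in `ℝ³` has, along a
  subsequence `σ` and after translations `τ j`, a NON-EMPTY uniformly discrete local limit `X` (two-way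
  `ε`-matching on every ball `‖·‖ ≤ R`, eventually in `j`) EVERY site of which has site energy
  `Σ'_{q ∈ X, q ≠ p} V_LJ(|p − q|) = 2E*`, `E* = ⨅_Q e_LJ(Q)` (exact energy-transitivity).

THE LINE (card `Ideas/period-two-hull-point.md`, "bond-midpoint inversion"): a fault-free, equally spaced
layered set (`s (m+1) = −s m`, heights in arithmetic progression — a period-2 close-packed stacking, any rigid
motion) is EXACTLY energy-transitive for every pair potential (in-layer and two-layer translations, and the point
reflection through the midpoint of an inter-layer bond; in layer-cake form: the site energy of layer `m` is
`Φ₀ + Σ'_{m' ≠ m} Φ(z m' − z m, L m' − L m)` and `Φ` is even in the letter offset). The LANDED chain of item 11779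
(`LayeredHull.stub_extraction → stub_recurrence → stub_closing`, fed by `stub_windowBounds`, `stub_registry`,
`stub_convexity`, `stub_layerCake`; Theorems/PhononSlackCertificatesPeriodicGivenLayered*.lean, all sorry-free)
produces exactly such a set INSIDE THE HULL of the ground states from layered windows at every scale; the window
bounds (U)/(L) on the prisms of `stub_layerCake` and `E(M)/M → E*` (`crysEnergyLimit`) pin the common site energy
at `2E*`; diagonal extraction turns "in the hull, frequently in `N`" into the crux's subsequence clause.

Registered stubs (sorries live ONLY in `stub_*`):

* `stub_layeredWindows` — BOARD INPUT, verbatim the rank-2 crux `HullMinimality.LayeredWindows`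
  (stmt-AtomisticToContinuum-11778; fed by `LaminarBarlowWindows` stmt-14292 through the landed
  `PeriodicWindowsSketch.LayeredWindows_of_laminarBarlowWindows`). Not worked inside this line.
* `stub_periodTwoHullPoint` (S, provable now) — re-export of 11779's internal endpoint BEFORE packaging: layered
  windows at every scale ⇒ a fault-free, equally spaced layered set in the hull.
* `stub_siteSum_const` (M, provable now) — MotifTwo inversion in layer-cake form: all site sums of a fault-free,
  equally spaced layered set are equal.
* `stub_level` (M, provable now; the lead's) — a layered set in the hull of a ground-state sequence whose site sums
  are all equal to `u` has `u = 2E*` ((U)/(L) on prisms, `crysEnergyLimit`).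
* `stub_extract` (S, provable now) — "in the hull, frequently in `N`" ⇒ `StrictMono σ`, `τ`, two-way matching on
  every ball, eventually in `j` (`Filter.extraction_forall_of_frequently`).
* `TransitiveLocalLimit_of_parts` — kernel-checked composition (sorry-free): stub₁-sig → … → stub₅-sig → crux text.
* `TransitiveLocalLimit_of` — the ONLY theorem concluding the crux BY NAME.

STATUS (lead c4, 2026-08-17T10:20Z): stubs 2–5 are LANDED (p154000, p154003, p153999, p153518; namespace
`…Theorems.TransitiveLocalLimitMotifTwo`) and referenced below; the ONLY remaining `sorry` is the board input
`stub_layeredWindows` = item stmt-11778 verbatim, i.e. `TransitiveLocalLimit` is reduced in-tree to `LayeredWindows`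
(`transitiveLocalLimit_of_layeredWindows`, Theorems/PerronTransitivityTransitiveLocalLimitOfLayeredWindows.lean).
CYCLE 2 (lead c4, 2026-08-17T11:40Z): two `--supports` files landed and their head theorems are registered below as
(closed) stubs, NOT used by `TransitiveLocalLimit_of`: Theorems/…EnergeticDoors.lean (p155608: two-sided
concentration ⇒ crux, L²-coercivity ⇒ crux, size-biased floor ⇒ crux — the doors of lines `birth` / `Sketch`) and
Theorems/…FiniteForm.lean (p156324: `transitiveLocalLimit_iff_goodBalls`, the crux ⟺ its finite-`N` form "good
balls frequently", and door 0 `transitiveLocalLimit_of_goodBalls`). Doors into the crux now in tree: 15098 (K*) |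
0751 (BulkDefectVanish) | 11778 (LayeredWindows, this line) | size-biased floor (unfiled) | good balls (≡ crux).

Disproof.lean (rev 3) honoured: minimality enters through (U) (`wb_upper` is a cut-and-paste in the finite ground
states); the level `2E*` is derived, not assumed; the limit set is infinite and `1/2`-separated (`cake_separated`).
-/

noncomputable section

namespace Summit.AtomisticToContinuum.Crystallization.Cruxes.TransitiveLocalLimit.MotifTwo

open Filter
open Literature.MathematicalPhysics.StatisticalMechanics
open Summit.AtomisticToContinuum.Crystallization.Theorems.LayeredHull

/-! ## Registered stubs (sorries live ONLY here; one-line signatures WITHOUT `let` (a registered signature is cut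
at the first `:=`), names opened as above; the layered set is a NAMED argument `S` with its defining equation) -/

/-- **STUB 1 — BOARD INPUT `LayeredWindows`** (stmt-AtomisticToContinuum-11778, rank-2 crux of route
`HullMinimality`, verbatim): every Lennard-Jones ground-state sequence has layered windows at every scale,
frequently in `N` (one in-layer spacing `a ∈ [47/50, 1]`, free Hägg word, free gaps in `[39a/50, 17a/20]`, one
rigid motion per window). This is the line's transfer hypothesis `C⁺`; it is an existing item, not worked here. -/
theorem stub_layeredWindows : Summit.AtomisticToContinuum.Crystallization.Theses.HullMinimality.LayeredWindows := by
  sorry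

/-- **STUB 2 — A PERIOD-TWO HULL POINT FROM LAYERED WINDOWS** (size S; provable now): for a ground-state sequence
`x` with layered windows at every scale (common `a`), some FAULT-FREE (`s (m+1) = −s m`), EQUALLY SPACED layered set
`A(S(a, s, z))` lies in the hull of `x` (two-way matched on every ball by translates of `x N`, frequently in `N`).
Proof: `stub_extraction` → `stub_recurrence` → `stub_closing` (with `stub_windowBounds`, `stub_registry`,
`stub_convexity`, `stub_layerCake`), exactly as in `PeriodicGivenLayered_of` but stopping before `pgl_readoff`. -/
theorem stub_periodTwoHullPoint : ∀ x : (N : ℕ) → (Fin N → EuclideanSpace ℝ (Fin 3)), (∀ N, IsGroundState lennardJones (x N)) → ∀ a : ℝ, 47 / 50 ≤ a → a ≤ 1 → (∀ R ε : ℝ, 0 < ε → ∃ᶠ N in atTop, ∃ (A : EuclideanSpace ℝ (Fin 3) →ₗᵢ[ℝ] EuclideanSpace ℝ (Fin 3)) (t : EuclideanSpace ℝ (Fin 3)) (s : ℤ → ℤ) (z : ℤ → ℝ), IsHaggSeq s ∧ (∀ m : ℤ, 39 / 50 * a ≤ z (m + 1) - z m ∧ z (m + 1) - z m ≤ 17 /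 20 * a) ∧ ((∀ p ∈ {p : EuclideanSpace ℝ (Fin 3) | ∃ m i j : ℤ, p = A (((i : ℝ) • triangularVec₁ a) + ((j : ℝ) • triangularVec₂ a) + ((haggLabel s m : ℝ) • barlowOffset a) + (z m • layerNormal 1))}, ‖p‖ ≤ R → ∃ i : Fin N, dist (x N i + t) p ≤ ε) ∧ (∀ i : Fin N, ‖x N i + t‖ ≤ R → ∃ p ∈ {p : EuclideanSpace ℝ (Fin 3) | ∃ m i j : ℤ, p = A (((i : ℝ) • triangularVec₁ a) + ((j : ℝ) • triangularVec₂ a) + ((haggLabel s m : ℝ) • barlowOffset a) + (z m • layerNormal 1))}, dist (x N i + t) p ≤ ε))) → ∃ (A : EuclideanSpace ℝ (Fin 3) →ₗᵢ[ℝ] EuclideanSpace ℝ (Fin 3)) (s : ℤ → ℤ) (z : ℤ → ℝ) (S : Set (EuclideanSpace ℝ (Fin 3))), S = {p : EuclideanSpace ℝ (Fin 3) | ∃ m i j : ℤ, p = A (((i : ℝ) • triangularVec₁ a) + ((j : ℝ) • triangularVec₂ a) + ((haggLabel s m : ℝ) • barlowOffset a) + (z m • layerNormal 1))} ∧ IsHaggSeq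 s ∧ (∀ m : ℤ, 39 / 50 * a ≤ z (m + 1) - z m ∧ z (m + 1) - z m ≤ 17 / 20 * a) ∧ (∀ m : ℤ, s (m + 1) = -s m) ∧ (∀ m : ℤ, z (m + 2) - z (m + 1) = z (m + 1) - z m) ∧ ∀ R ε : ℝ, 0 < ε → ∃ᶠ N in atTop, ∃ t : EuclideanSpace ℝ (Fin 3), (∀ p ∈ S, ‖p‖ ≤ R → ∃ i : Fin N, dist (x N i + t) p ≤ ε) ∧ (∀ i : Fin N, ‖x N i + t‖ ≤ R → ∃ p ∈ S, dist (x N i + t) p ≤ ε) :=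
  -- LANDED p154000: Theorems/PerronTransitivityTransitiveLocalLimitStubPeriodTwoHullPoint.lean (this stub is closed)
  Summit.AtomisticToContinuum.Crystallization.Theorems.TransitiveLocalLimitMotifTwo.stub_periodTwoHullPoint

/-- **STUB 3 — MOTIF-TWO INVERSION (layer-cake form)** (size M; provable now): in a fault-free, equally spaced
layered set all site sums are equal. Proof: `cake_siteEnergy` writes the site sum of a point of layer `m` as
`Φ₀(a) + Σ'_{m'} (if m' = m then 0 else layerInteraction V_LJ a (z m' − z m) (L m' − L m) 1)`, independent of the
in-layer position; for a fault-free word `L m = haggLabel s m` is `0` on even and `s 0` on odd layers, so with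
arithmetic heights the reindexing `m' ↦ m' + 1` maps the family at `m` to the family at `m + 1` up to the sign of
the letter offset, which `layerInteraction_neg_offset` removes; induction in `m` (both directions). -/
theorem stub_siteSum_const : ∀ a : ℝ, 47 / 50 ≤ a → a ≤ 1 → ∀ (A : EuclideanSpace ℝ (Fin 3) →ₗᵢ[ℝ] EuclideanSpace ℝ (Fin 3)) (s : ℤ → ℤ) (z : ℤ → ℝ), (∀ m : ℤ, 39 / 50 * a ≤ z (m + 1) - z m) → (∀ m : ℤ, s (m + 1) = -s m) → (∀ m : ℤ, z (m + 2) - z (m + 1) = z (m + 1) - z m) → ∀ S : Set (EuclideanSpace ℝ (Fin 3)), S = {p : EuclideanSpace ℝ (Fin 3) | ∃ m i j : ℤ, p = A (((i : ℝ) • triangularVec₁ a) + ((j : ℝ) • triangularVec₂ a) + ((haggLabel s m : ℝ) • barlowOffset a) + (z m • layerNormal 1))} → ∀ p ∈ S, ∀ p' ∈ S, (∑' q : {q : EuclideanSpace ℝ (Fin 3) // q ∈ S ∧ q ≠ p}, lennardJones (dist p (q : EuclideanSpace ℝ (Fin 3)))) = (∑' q : {q : EuclideanSpace ℝ (Fin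 3) // q ∈ S ∧ q ≠ p'}, lennardJones (dist p' (q : EuclideanSpace ℝ (Fin 3)))) :=
  -- LANDED p154003: Theorems/PerronTransitivityTransitiveLocalLimitStubSiteSumConst.lean (this stub is closed)
  Summit.AtomisticToContinuum.Crystallization.Theorems.TransitiveLocalLimitMotifTwo.stub_siteSum_const

/-- **STUB 4 — THE LEVEL IS `2E*`** (size M; provable now; the lead's stub): if a layered set `S = A(S(a, s, z))`
(`a ∈ [47/50, 1]`, gaps in the box) lies in the hull of a Lennard-Jones ground-state sequence and all its site sums
equal `u`, then `u = 2E*`. Proof: on the prisms `W(0, K, K)` of `stub_layerCake` (`#W = K³`, `∂W ≤ C (K² + K²)`),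
`Σ_W e_p = K³ u`; (U) `wb_upper` (needs the hull) and (L) `wb_lower` (needs the `1/2`-separation of
`cake_separated`) give `|K³ u − 2 E(K³)| ≤ C' K²`, and `E(K³)/K³ → E*` (`crysEnergyLimit` along `K ↦ K³`). -/
theorem stub_level : ∀ x : (N : ℕ) → (Fin N → EuclideanSpace ℝ (Fin 3)), (∀ N, IsGroundState lennardJones (x N)) → ∀ a : ℝ, 47 / 50 ≤ a → a ≤ 1 → ∀ (A : EuclideanSpace ℝ (Fin 3) →ₗᵢ[ℝ] EuclideanSpace ℝ (Fin 3)) (s : ℤ → ℤ) (z : ℤ → ℝ), IsHaggSeq s → (∀ m : ℤ, 39 / 50 * a ≤ z (m + 1) - z m ∧ z (m + 1) - z m ≤ 17 / 20 * a) → ∀ S : Set (EuclideanSpace ℝ (Fin 3)), S = {p : EuclideanSpace ℝ (Fin 3) | ∃ m i j : ℤ, p = A (((i : ℝ) • triangularVec₁ a) + ((j : ℝ) • triangularVec₂ a) + ((haggLabel s m : ℝ) • barlowOffset a) + (z m • layerNormal 1))} → (∀ R ε : ℝ, 0 < ε → ∃ᶠ N in atTop, ∃ t : EuclideanSpace ℝ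 (Fin 3), (∀ p ∈ S, ‖p‖ ≤ R → ∃ i : Fin N, dist (x N i + t) p ≤ ε) ∧ (∀ i : Fin N, ‖x N i + t‖ ≤ R → ∃ p ∈ S, dist (x N i + t) p ≤ ε)) → ∀ u : ℝ, (∀ p ∈ S, (∑' q : {q : EuclideanSpace ℝ (Fin 3) // q ∈ S ∧ q ≠ p}, lennardJones (dist p (q : EuclideanSpace ℝ (Fin 3)))) = u) → u = 2 * ⨅ Q : PeriodicConfiguration 3, Q.energyPerParticle lennardJones :=
  -- LANDED p153999: Theorems/PerronTransitivityTransitiveLocalLimitStubLevel.lean (this stub is closed)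
  Summit.AtomisticToContinuum.Crystallization.Theorems.TransitiveLocalLimitMotifTwo.stub_level

/-- **STUB 5 — DIAGONAL EXTRACTION** (size S; provable now; pure filter bookkeeping): a set matched on every ball
by translates of `x N`, frequently in `N`, is a local limit along a subsequence: some `StrictMono σ` and translations
`τ j` give two-way `ε`-matching on `‖·‖ ≤ R` EVENTUALLY in `j`, for every `R` and `ε > 0`. Proof: extract along the
scales `(j+1, 1/(j+1))` with `Filter.extraction_forall_of_frequently`, `choose` the translations, monotonicity of
matching in the scale (cf. `PrestressSplitKorn.hull_match_mono`, `hull_eventually_scale`). -/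
theorem stub_extract : ∀ (x : (N : ℕ) → (Fin N → EuclideanSpace ℝ (Fin 3))) (S : Set (EuclideanSpace ℝ (Fin 3))), (∀ R ε : ℝ, 0 < ε → ∃ᶠ N in atTop, ∃ t : EuclideanSpace ℝ (Fin 3), (∀ p ∈ S, ‖p‖ ≤ R → ∃ i : Fin N, dist (x N i + t) p ≤ ε) ∧ (∀ i : Fin N, ‖x N i + t‖ ≤ R → ∃ p ∈ S, dist (x N i + t) p ≤ ε)) → ∃ (σ : ℕ → ℕ) (τ : ℕ → EuclideanSpace ℝ (Fin 3)), StrictMono σ ∧ ∀ R ε : ℝ, 0 < ε → ∀ᶠ j : ℕ in atTop, (∀ p ∈ S, ‖p‖ ≤ R → ∃ i : Fin (σ j), dist (x (σ j) i + τ j) p ≤ ε) ∧ (∀ i : Fin (σ j), ‖x (σ j) i + τ j‖ ≤ R → ∃ p ∈ S, dist (x (σ j) i + τ j) p ≤ ε) :=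
  -- LANDED p153518: Theorems/PerronTransitivityTransitiveLocalLimitStubExtract.lean (this stub is closed)
  Summit.AtomisticToContinuum.Crystallization.Theorems.TransitiveLocalLimitMotifTwo.stub_extract

/-! ## The kernel-checked composition (no `sorry` of its own) -/

/-- THE REAL PROOF (sorry-free): `stub₁-sig → stub₂-sig → stub₃-sig → stub₄-sig → stub₅-sig → <the crux statement>`;
the conclusion is the text of the route decl `PerronTransitivity.TransitiveLocalLimit` VERBATIM (spelled out, so that
exactly ONE theorem of this file — `TransitiveLocalLimit_of` — concludes the crux BY NAME). The limit set is the
period-two layered hull point itself: non-empty (it contains `A(z 0 • e₃)`), `1/2`-separated (`cake_separated`),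
reached along the extracted subsequence, and every site sum equals the common value `u = 2E*`. -/
theorem TransitiveLocalLimit_of_parts
    (h1 : Summit.AtomisticToContinuum.Crystallization.Theses.HullMinimality.LayeredWindows)
    (h2 : ∀ x : (N : ℕ) → (Fin N → EuclideanSpace ℝ (Fin 3)), (∀ N, IsGroundState lennardJones (x N)) → ∀ a : ℝ, 47 / 50 ≤ a → a ≤ 1 → (∀ R ε : ℝ, 0 < ε → ∃ᶠ N in atTop, ∃ (A : EuclideanSpace ℝ (Fin 3) →ₗᵢ[ℝ] EuclideanSpace ℝ (Fin 3)) (t : EuclideanSpace ℝ (Fin 3)) (s : ℤ → ℤ) (z : ℤ → ℝ), IsHaggSeq s ∧ (∀ m : ℤ, 39 / 50 * a ≤ z (m + 1) - z m ∧ z (m + 1) - z m ≤ 17 / 20 * a) ∧ ((∀ p ∈ {p : EuclideanSpace ℝ (Fin 3) | ∃ m i j : ℤ, p = A (((i : ℝ) • triangularVec₁ a) + ((j : ℝ) • triangularVec₂ a) + ((haggLabel s m : ℝ) • barlowOffset a) + (z m • layerNormal 1))}, ‖p‖ ≤ R → ∃ i : Fin N, dist (x N i + t) p ≤ ε) ∧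 (∀ i : Fin N, ‖x N i + t‖ ≤ R → ∃ p ∈ {p : EuclideanSpace ℝ (Fin 3) | ∃ m i j : ℤ, p = A (((i : ℝ) • triangularVec₁ a) + ((j : ℝ) • triangularVec₂ a) + ((haggLabel s m : ℝ) • barlowOffset a) + (z m • layerNormal 1))}, dist (x N i + t) p ≤ ε))) → ∃ (A : EuclideanSpace ℝ (Fin 3) →ₗᵢ[ℝ] EuclideanSpace ℝ (Fin 3)) (s : ℤ → ℤ) (z : ℤ → ℝ) (S : Set (EuclideanSpace ℝ (Fin 3))), S = {p : EuclideanSpace ℝ (Fin 3) | ∃ m i j : ℤ, p = A (((i : ℝ) • triangularVec₁ a) + ((j : ℝ) • triangularVec₂ a) + ((haggLabel s m : ℝ) • barlowOffset a) + (z m • layerNormal 1))} ∧ IsHaggSeq s ∧ (∀ m : ℤ, 39 / 50 * a ≤ z (m + 1) - z m ∧ z (m + 1) - z m ≤ 17 / 20 * a) ∧ (∀ m : ℤ, s (m + 1) = -s m) ∧ (∀ m : ℤ, z (m + 2) - z (m + 1) = z (m + 1) - z m) ∧ ∀ R ε : ℝ, 0 < ε → ∃ᶠ N in atTop, ∃ t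 : EuclideanSpace ℝ (Fin 3), (∀ p ∈ S, ‖p‖ ≤ R → ∃ i : Fin N, dist (x N i + t) p ≤ ε) ∧ (∀ i : Fin N, ‖x N i + t‖ ≤ R → ∃ p ∈ S, dist (x N i + t) p ≤ ε))
    (h3 : ∀ a : ℝ, 47 / 50 ≤ a → a ≤ 1 → ∀ (A : EuclideanSpace ℝ (Fin 3) →ₗᵢ[ℝ] EuclideanSpace ℝ (Fin 3)) (s : ℤ → ℤ) (z : ℤ → ℝ), (∀ m : ℤ, 39 / 50 * a ≤ z (m + 1) - z m) → (∀ m : ℤ, s (m + 1) = -s m) → (∀ m : ℤ, z (m + 2) - z (m + 1) = z (m + 1) - z m) → ∀ S : Set (EuclideanSpace ℝ (Fin 3)), S = {p : EuclideanSpace ℝ (Fin 3) | ∃ m i j : ℤ, p = A (((i : ℝ) • triangularVec₁ a) + ((j : ℝ) • triangularVec₂ a) + ((haggLabel s m : ℝ) • barlowOffset a) + (z m • layerNormal 1))} → ∀ p ∈ S, ∀ p' ∈ S, (∑' q : {q : EuclideanSpace ℝ (Fin 3) // q ∈ S ∧ q ≠ p}, lennardJones (dist p (q : EuclideanSpace ℝ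 (Fin 3)))) = (∑' q : {q : EuclideanSpace ℝ (Fin 3) // q ∈ S ∧ q ≠ p'}, lennardJones (dist p' (q : EuclideanSpace ℝ (Fin 3)))))
    (h4 : ∀ x : (N : ℕ) → (Fin N → EuclideanSpace ℝ (Fin 3)), (∀ N, IsGroundState lennardJones (x N)) → ∀ a : ℝ, 47 / 50 ≤ a → a ≤ 1 → ∀ (A : EuclideanSpace ℝ (Fin 3) →ₗᵢ[ℝ] EuclideanSpace ℝ (Fin 3)) (s : ℤ → ℤ) (z : ℤ → ℝ), IsHaggSeq s → (∀ m : ℤ, 39 / 50 * a ≤ z (m + 1) - z m ∧ z (m + 1) - z m ≤ 17 / 20 * a) → ∀ S : Set (EuclideanSpace ℝ (Fin 3)), S = {p : EuclideanSpace ℝ (Fin 3) | ∃ m i j : ℤ, p = A (((i : ℝ) • triangularVec₁ a) + ((j : ℝ) • triangularVec₂ a) + ((haggLabel s m : ℝ) • barlowOffset a) + (z m • layerNormal 1))} → (∀ R ε : ℝ, 0 < ε → ∃ᶠ N in atTop, ∃ t : EuclideanSpace ℝ (Fin 3), (∀ p ∈ S, ‖p‖ ≤ R → ∃ i : Fin N,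 dist (x N i + t) p ≤ ε) ∧ (∀ i : Fin N, ‖x N i + t‖ ≤ R → ∃ p ∈ S, dist (x N i + t) p ≤ ε)) → ∀ u : ℝ, (∀ p ∈ S, (∑' q : {q : EuclideanSpace ℝ (Fin 3) // q ∈ S ∧ q ≠ p}, lennardJones (dist p (q : EuclideanSpace ℝ (Fin 3)))) = u) → u = 2 * ⨅ Q : PeriodicConfiguration 3, Q.energyPerParticle lennardJones)
    (h5 : ∀ (x : (N : ℕ) → (Fin N → EuclideanSpace ℝ (Fin 3))) (S : Set (EuclideanSpace ℝ (Fin 3))), (∀ R ε : ℝ, 0 < ε → ∃ᶠ N in atTop, ∃ t : EuclideanSpace ℝ (Fin 3), (∀ p ∈ S, ‖p‖ ≤ R → ∃ i : Fin N, dist (x N i + t) p ≤ ε) ∧ (∀ i : Fin N, ‖x N i + t‖ ≤ R → ∃ p ∈ S, dist (x N i + t) p ≤ ε)) → ∃ (σ : ℕ → ℕ) (τ : ℕ → EuclideanSpace ℝ (Fin 3)), StrictMono σ ∧ ∀ R ε : ℝ, 0 < ε → ∀ᶠ j : ℕ in atTop, (∀ p ∈ S, ‖p‖ ≤ R → ∃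 i : Fin (σ j), dist (x (σ j) i + τ j) p ≤ ε) ∧ (∀ i : Fin (σ j), ‖x (σ j) i + τ j‖ ≤ R → ∃ p ∈ S, dist (x (σ j) i + τ j) p ≤ ε)) :
    ∀ x : (N : ℕ) → (Fin N → EuclideanSpace ℝ (Fin 3)), (∀ N, Literature.MathematicalPhysics.StatisticalMechanics.IsGroundState Literature.MathematicalPhysics.StatisticalMechanics.lennardJones (x N)) → ∃ (X : Set (EuclideanSpace ℝ (Fin 3))) (σ : ℕ → ℕ) (τ : ℕ → EuclideanSpace ℝ (Fin 3)), X.Nonempty ∧ (∃ δ : ℝ, 0 < δ ∧ ∀ p ∈ X, ∀ q ∈ X, p ≠ q → δ ≤ dist p q) ∧ StrictMono σ ∧ (∀ R ε : ℝ, 0 < ε → ∀ᶠ j : ℕ in Filter.atTop, (∀ p ∈ X, ‖p‖ ≤ R → ∃ i : Fin (σ j), dist (x (σ j) i + τ j) p ≤ ε) ∧ (∀ i : Fin (σ j), ‖x (σ j) i + τ j‖ ≤ R → ∃ p ∈ X, dist (x (σ j) i + τ j) p ≤ ε)) ∧ ∀ p ∈ X, ∑' q : {q : EuclideanSpace ℝ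 (Fin 3) // q ∈ X ∧ q ≠ p}, Literature.MathematicalPhysics.StatisticalMechanics.lennardJones (dist p q.1) = 2 * ⨅ Q : Literature.MathematicalPhysics.StatisticalMechanics.PeriodicConfiguration 3, Q.energyPerParticle Literature.MathematicalPhysics.StatisticalMechanics.lennardJones := by
  intro x hx
  -- (1) board input: layered windows at every scale, common in-layer spacing `a`
  obtain ⟨a, ha, ha1, hW⟩ := h1 x hx
  -- (2) a fault-free, equally spaced layered set `S` in the hull (named, with its defining equation)
  obtain ⟨A, s, z, S, hS, hs, hz, hfault, hconst, hH⟩ := h2 x hx a ha ha1 hW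
  have hz1 : ∀ m : ℤ, 39 / 50 * a ≤ z (m + 1) - z m := fun m => (hz m).1
  -- the set is non-empty and `1/2`-separated
  have hp₀ : A ((((0 : ℤ) : ℝ) • triangularVec₁ a) + (((0 : ℤ) : ℝ) • triangularVec₂ a) +
      ((haggLabel s 0 : ℝ) • barlowOffset a) + (z 0 • layerNormal 1)) ∈ S := by
    rw [hS]; exact ⟨0, 0, 0, rfl⟩
  have hne : S.Nonempty := ⟨_, hp₀⟩
  have hsep : ∀ p ∈ S, ∀ q ∈ S, p ≠ q → 1 / 2 ≤ dist p q := by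
    subst hS; exact cake_separated a ha A s z hz1
  -- (3) all site sums equal the site sum `u` at the base point
  have hu : ∀ p ∈ S, (∑' q : {q : EuclideanSpace ℝ (Fin 3) // q ∈ S ∧ q ≠ p},
      lennardJones (dist p (q : EuclideanSpace ℝ (Fin 3)))) = _ :=
    fun p hp => h3 a ha ha1 A s z hz1 hfault hconst S hS p hp _ hp₀
  -- (4) the level is `2E*`
  have hlevel := h4 x hx a ha ha1 A s z hs hz S hS hH _ hu
  -- (5) subsequence and translations
  obtain ⟨σ, τ, hσ, hmatch⟩ := h5 x S hH
  refine ⟨S, σ, τ, hne, ⟨1 / 2, one_half_pos, hsep⟩, hσ, hmatch, fun p hp => ?_⟩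
  rw [← hlevel]
  exact hu p hp

/-- THE SKELETON THEOREM: the five registered stubs compose to the crux, concluded BY NAME (the route decl
`Summit.AtomisticToContinuum.Crystallization.Theses.PerronTransitivity.TransitiveLocalLimit`); its only `sorry`s are
the stubs'. With stubs 2–5 landed this is `LayeredWindows → TransitiveLocalLimit` applied to the board input. -/
theorem TransitiveLocalLimit_of : Summit.AtomisticToContinuum.Crystallization.Theses.PerronTransitivity.TransitiveLocalLimit :=
  TransitiveLocalLimit_of_parts stub_layeredWindows stub_periodTwoHullPoint stub_siteSum_const stub_level stub_extract

/-! ## Registered energetic doors (cycle 2; each `H → crux`, landed in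
`Theorems/PerronTransitivityTransitiveLocalLimitEnergeticDoors.lean`, namespace `…Theorems.TransitiveLocalLimitBirth`;
registered here so that the helper file rides `--supports` (p155608 ACCEPTED); NOT used by `TransitiveLocalLimit_of`) -/

/-- **DOOR (two-sided concentration ⇒ crux)** — the weakest energetic door: two-sided concentration in density of
the finite-`N` site energies at `2E*` along every ground-state sequence gives the crux (birth's landed composition). -/
theorem transitiveLocalLimit_of_concentration : (∀ x : (N : ℕ) → (Fin N → EuclideanSpace ℝ (Fin 3)), (∀ N, Literature.MathematicalPhysics.StatisticalMechanics.IsGroundState Literature.MathematicalPhysics.StatisticalMechanics.lennardJones (x N)) → ∀ θ : ℝ, 0 < θ → Filter.Tendsto (fun N : ℕ => ((Finset.univ.filter fun i : Fin N => θ < |Literature.MathematicalPhysics.StatisticalMechanics.siteEnergy Literature.MathematicalPhysics.StatisticalMechanics.lennardJones (x N) i - 2 * (⨅ Q : Literature.MathematicalPhysics.StatisticalMechanics.PeriodicConfiguration 3, Q.energyPerParticle Literature.MathematicalPhysics.StatisticalMechanics.lennardJones)|).card : ℝ) / N) Filter.atTop (nhds 0)) → ∀ x : (N : ℕ) → (Fin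 N → EuclideanSpace ℝ (Fin 3)), (∀ N, Literature.MathematicalPhysics.StatisticalMechanics.IsGroundState Literature.MathematicalPhysics.StatisticalMechanics.lennardJones (x N)) → ∃ (X : Set (EuclideanSpace ℝ (Fin 3))) (σ : ℕ → ℕ) (τ : ℕ → EuclideanSpace ℝ (Fin 3)), X.Nonempty ∧ (∃ δ : ℝ, 0 < δ ∧ ∀ p ∈ X, ∀ q ∈ X, p ≠ q → δ ≤ dist p q) ∧ StrictMono σ ∧ (∀ R ε : ℝ, 0 < ε → ∀ᶠ j : ℕ in Filter.atTop, (∀ p ∈ X, ‖p‖ ≤ R → ∃ i : Fin (σ j), dist (x (σ j) i + τ j) p ≤ ε) ∧ (∀ i : Fin (σ j), ‖x (σ j) i + τ j‖ ≤ R → ∃ p ∈ X, dist (x (σ j) i + τ j) p ≤ ε)) ∧ ∀ p ∈ X, ∑' q : {q : EuclideanSpace ℝ (Fin 3) // q ∈ X ∧ q ≠ p}, Literature.MathematicalPhysics.StatisticalMechanics.lennardJones (dist p q.1) = 2 * ⨅ Q : Literature.MathematicalPhysics.StatisticalMechanics.PeriodicConfiguration 3, Q.energyPerParticle Literature.MathematicalPhysics.StatisticalMechanics.lennardJones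 :=
  -- LANDED p155608: Theorems/PerronTransitivityTransitiveLocalLimitEnergeticDoors.lean (this door is closed)
  Summit.AtomisticToContinuum.Crystallization.Theorems.TransitiveLocalLimitBirth.transitiveLocalLimit_of_concentration

/-- **DOOR (L²-coercivity ⇒ crux)**: `Σᵢ (𝓔ⁱ(x) − 2E*)² ≤ A·(E_LJ(x) − N·E*)` on every ground state gives the crux. -/
theorem transitiveLocalLimit_of_l2Coercive : (∃ A : ℝ, ∀ (N : ℕ) (x : Fin N → EuclideanSpace ℝ (Fin 3)), Literature.MathematicalPhysics.StatisticalMechanics.IsGroundState Literature.MathematicalPhysics.StatisticalMechanics.lennardJones x → ∑ i, (Literature.MathematicalPhysics.StatisticalMechanics.siteEnergy Literature.MathematicalPhysics.StatisticalMechanics.lennardJones x i - 2 * (⨅ Q : Literature.MathematicalPhysics.StatisticalMechanics.PeriodicConfiguration 3, Q.energyPerParticle Literature.MathematicalPhysics.StatisticalMechanics.lennardJones)) ^ 2 ≤ A * (Literature.MathematicalPhysics.StatisticalMechanics.interactionEnergy Literature.MathematicalPhysics.StatisticalMechanics.lennardJones x - N * (⨅ Q : Literature.MathematicalPhysics.StatisticalMechanics.PeriodicConfiguration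 3, Q.energyPerParticle Literature.MathematicalPhysics.StatisticalMechanics.lennardJones))) → ∀ x : (N : ℕ) → (Fin N → EuclideanSpace ℝ (Fin 3)), (∀ N, Literature.MathematicalPhysics.StatisticalMechanics.IsGroundState Literature.MathematicalPhysics.StatisticalMechanics.lennardJones (x N)) → ∃ (X : Set (EuclideanSpace ℝ (Fin 3))) (σ : ℕ → ℕ) (τ : ℕ → EuclideanSpace ℝ (Fin 3)), X.Nonempty ∧ (∃ δ : ℝ, 0 < δ ∧ ∀ p ∈ X, ∀ q ∈ X, p ≠ q → δ ≤ dist p q) ∧ StrictMono σ ∧ (∀ R ε : ℝ, 0 < ε → ∀ᶠ j : ℕ in Filter.atTop, (∀ p ∈ X, ‖p‖ ≤ R → ∃ i : Fin (σ j), dist (x (σ j) i + τ j) p ≤ ε) ∧ (∀ i : Fin (σ j), ‖x (σ j) i + τ j‖ ≤ R → ∃ p ∈ X, dist (x (σ j) i + τ j) p ≤ ε)) ∧ ∀ p ∈ X, ∑' q : {q : EuclideanSpace ℝ (Fin 3) // q ∈ X ∧ q ≠ p}, Literature.MathematicalPhysics.StatisticalMechanics.lennardJones (dist p q.1) = 2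 * ⨅ Q : Literature.MathematicalPhysics.StatisticalMechanics.PeriodicConfiguration 3, Q.energyPerParticle Literature.MathematicalPhysics.StatisticalMechanics.lennardJones :=
  -- LANDED p155608: Theorems/PerronTransitivityTransitiveLocalLimitEnergeticDoors.lean (this door is closed)
  Summit.AtomisticToContinuum.Crystallization.Theorems.TransitiveLocalLimitBirth.transitiveLocalLimit_of_l2Coercive

/-- **DOOR (size-biased floor ⇒ crux)** (crux idea `size-biased-floor`): `Σᵢ 𝓔ⁱ(x)² ≤ 2E*·Σᵢ 𝓔ⁱ(x)` on every
ground state gives the crux. -/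
theorem transitiveLocalLimit_of_sizeBiasedFloor : (∀ (N : ℕ) (x : Fin N → EuclideanSpace ℝ (Fin 3)), Literature.MathematicalPhysics.StatisticalMechanics.IsGroundState Literature.MathematicalPhysics.StatisticalMechanics.lennardJones x → ∑ i, Literature.MathematicalPhysics.StatisticalMechanics.siteEnergy Literature.MathematicalPhysics.StatisticalMechanics.lennardJones x i ^ 2 ≤ 2 * (⨅ Q : Literature.MathematicalPhysics.StatisticalMechanics.PeriodicConfiguration 3, Q.energyPerParticle Literature.MathematicalPhysics.StatisticalMechanics.lennardJones) * ∑ i, Literature.MathematicalPhysics.StatisticalMechanics.siteEnergy Literature.MathematicalPhysics.StatisticalMechanics.lennardJones x i) → ∀ x : (N : ℕ) → (Fin N → EuclideanSpace ℝ (Fin 3)), (∀ N, Literature.MathematicalPhysics.StatisticalMechanics.IsGroundState Literature.MathematicalPhysics.StatisticalMechanics.lennardJones (x N)) → ∃ (X : Set (EuclideanSpace ℝ (Fin 3))) (σ : ℕ → ℕ) (τ : ℕ → EuclideanSpace ℝ (Fin 3)), X.Nonempty ∧ (∃ δ : ℝ, 0 < δ ∧ ∀ p ∈ X, ∀ q ∈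 X, p ≠ q → δ ≤ dist p q) ∧ StrictMono σ ∧ (∀ R ε : ℝ, 0 < ε → ∀ᶠ j : ℕ in Filter.atTop, (∀ p ∈ X, ‖p‖ ≤ R → ∃ i : Fin (σ j), dist (x (σ j) i + τ j) p ≤ ε) ∧ (∀ i : Fin (σ j), ‖x (σ j) i + τ j‖ ≤ R → ∃ p ∈ X, dist (x (σ j) i + τ j) p ≤ ε)) ∧ ∀ p ∈ X, ∑' q : {q : EuclideanSpace ℝ (Fin 3) // q ∈ X ∧ q ≠ p}, Literature.MathematicalPhysics.StatisticalMechanics.lennardJones (dist p q.1) = 2 * ⨅ Q : Literature.MathematicalPhysics.StatisticalMechanics.PeriodicConfiguration 3, Q.energyPerParticle Literature.MathematicalPhysics.StatisticalMechanics.lennardJones :=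
  -- LANDED p155608: Theorems/PerronTransitivityTransitiveLocalLimitEnergeticDoors.lean (this door is closed)
  Summit.AtomisticToContinuum.Crystallization.Theorems.TransitiveLocalLimitBirth.transitiveLocalLimit_of_sizeBiasedFloor

/-! ## Registered finite-form stubs (cycle 2; landed in `Theorems/PerronTransitivityTransitiveLocalLimitFiniteForm.lean`,
namespace `…Theorems.TransitiveLocalLimitBirth`; registered so that the helper file rides `--supports`; NOT used by
`TransitiveLocalLimit_of`) -/

/-- **DOOR 0 (good balls frequently ⇒ crux)** — the weakest door of all: at every radius and tolerance, frequently in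
`N`, some particle of the ground state has its whole `R`-ball `θ`-transitive. -/
theorem transitiveLocalLimit_of_goodBalls : (∀ x : (N : ℕ) → (Fin N → EuclideanSpace ℝ (Fin 3)), (∀ N, Literature.MathematicalPhysics.StatisticalMechanics.IsGroundState Literature.MathematicalPhysics.StatisticalMechanics.lennardJones (x N)) → ∀ R θ : ℝ, 0 < θ → ∃ᶠ N in Filter.atTop, ∃ i : Fin N, ∀ i' : Fin N, dist (x N i) (x N i') ≤ R → |Literature.MathematicalPhysics.StatisticalMechanics.siteEnergy Literature.MathematicalPhysics.StatisticalMechanics.lennardJones (x N) i' - 2 * (⨅ Q : Literature.MathematicalPhysics.StatisticalMechanics.PeriodicConfiguration 3, Q.energyPerParticle Literature.MathematicalPhysics.StatisticalMechanics.lennardJones)| ≤ θ) → ∀ x : (N : ℕ) → (Fin N → EuclideanSpace ℝ (Fin 3)), (∀ N, Literature.MathematicalPhysics.StatisticalMechanics.IsGroundState Literature.MathematicalPhysics.StatisticalMechanics.lennardJones (x N)) → ∃ (X : Set (EuclideanSpace ℝ (Fin 3))) (σ : ℕ → ℕ) (τ : ℕ → EuclideanSpace ℝ (Fin 3)), X.Nonempty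 ∧ (∃ δ : ℝ, 0 < δ ∧ ∀ p ∈ X, ∀ q ∈ X, p ≠ q → δ ≤ dist p q) ∧ StrictMono σ ∧ (∀ R ε : ℝ, 0 < ε → ∀ᶠ j : ℕ in Filter.atTop, (∀ p ∈ X, ‖p‖ ≤ R → ∃ i : Fin (σ j), dist (x (σ j) i + τ j) p ≤ ε) ∧ (∀ i : Fin (σ j), ‖x (σ j) i + τ j‖ ≤ R → ∃ p ∈ X, dist (x (σ j) i + τ j) p ≤ ε)) ∧ ∀ p ∈ X, ∑' q : {q : EuclideanSpace ℝ (Fin 3) // q ∈ X ∧ q ≠ p}, Literature.MathematicalPhysics.StatisticalMechanics.lennardJones (dist p q.1) = 2 * ⨅ Q : Literature.MathematicalPhysics.StatisticalMechanics.PeriodicConfiguration 3, Q.energyPerParticle Literature.MathematicalPhysics.StatisticalMechanics.lennardJones :=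
  -- LANDED: Theorems/PerronTransitivityTransitiveLocalLimitFiniteForm.lean (this stub is closed)
  Summit.AtomisticToContinuum.Crystallization.Theorems.TransitiveLocalLimitBirth.transitiveLocalLimit_of_goodBalls

/-- **FINITE-`N` FORM OF THE CRUX**: `TransitiveLocalLimit` ↔ good balls frequently. -/
theorem transitiveLocalLimit_iff_goodBalls : Summit.AtomisticToContinuum.Crystallization.Theses.PerronTransitivity.TransitiveLocalLimit ↔ (∀ x : (N : ℕ) → (Fin N → EuclideanSpace ℝ (Fin 3)), (∀ N, Literature.MathematicalPhysics.StatisticalMechanics.IsGroundState Literature.MathematicalPhysics.StatisticalMechanics.lennardJones (x N)) → ∀ R θ : ℝ, 0 < θ → ∃ᶠ N in Filter.atTop, ∃ i : Fin N, ∀ i' : Fin N, dist (x N i) (x N i') ≤ R → |Literature.MathematicalPhysics.StatisticalMechanics.siteEnergy Literature.MathematicalPhysics.StatisticalMechanics.lennardJones (x N) i' - 2 * (⨅ Q : Literature.MathematicalPhysics.StatisticalMechanics.PeriodicConfiguration 3, Q.energyPerParticle Literature.MathematicalPhysics.StatisticalMechanics.lennardJones)| ≤ θ) :=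
  -- LANDED: Theorems/PerronTransitivityTransitiveLocalLimitFiniteForm.lean (this stub is closed)
  Summit.AtomisticToContinuum.Crystallization.Theorems.TransitiveLocalLimitBirth.transitiveLocalLimit_iff_goodBalls

end Summit.AtomisticToContinuum.Crystallization.Cruxes.TransitiveLocalLimit.MotifTwo

end
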